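import Summits.QuantumFields.YangMills.Theorems.AllWindowsColdBoxBoxHighLineGhostGreen
import Mathlib.LinearAlgebra.CrossProduct

/-!
# T-S5.7d input: the LINEAR ghost term vanishes — `tr (F₁⁻¹ · fpGen (X ∘ w)) = 0` for every su(2)-valued link field `w`
# (STUB-PLAN-S5-STEP2 §8 «NO linear term: tr(F₁⁻¹F⁽¹⁾) ≡ 0 — colour structure `pauliPerm·[a×]`, trace of an antisymmetric matrix»;
# planner ym-idea-2 g18 routing 2026-08-29T19:46:09Z (iii) `GhostTaylor`; LINE-19 S5 ⟨stmt-QuantumFields-24004⟩/⟨24335⟩)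

Width seat `ym-line-sfw-p2-w3` (g40).  For a link field of the form `W_e = X(w_e) = su2Coord (w_e)` (the LINEAR part of the edge chart
`↑(e^{i a_e}) − 1 = X(a_e) + …`), the Faddeev–Popov matrix ✓`GhostFP.fpGen H W` has the colour structure
`imVecM (X(θ_{e₋}) X(w_e) − X(w_e) X(θ_{e₊})) = −pauliPerm · ((θ_{e₋} + θ_{e₊}) × w_e)` (`X(u)X(v) = −(u·v)·1 − X(u × v)`,
`imVecM_linkLinM_su2Coord`), so against `F₁⁻¹ = −(G ⊗ pauliPerm)` (✓`fpOperator_one_inv`, `pauliPerm² = 1`) every diagonal block of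
`F₁⁻¹ · fpGen W` is a sum of `c`-components of `e_c × w` — which vanish (`cross_single_apply_self`).  Hence
**`GhostFP.trace_ghostX_su2Coord : (ghostX H (fun e => su2Coord (w e))).trace = 0`**: the ghost loop has NO term linear in the chart field.

Everything proved, no definitions, standard axioms.  HONEST LABEL: an input of ONE brick (7d) of STEP 2 of the XL stub S5 of a critic-PASSed DRAFT
line; 7d, S5, U5, ⟨24004⟩ ⟨24335⟩ ⟨24336⟩ remain OPEN; no crux, rung or summit is proved; **the Yang–Mills mass gap is NOT proved by this file.**
-/

set_option autoImplicit false

noncomputable section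

open Matrix Finset
open scoped Matrix Kronecker
open Literature.MathematicalPhysics.QuantumFieldTheory.Balaban1983to89.B10Eq18SigmaSU2 (su2Coord)
open Literature.MathematicalPhysics.QuantumLattice (LGConfig ZdEdge)
open Literature.Probability.LatticeModels (Site dirichletMatrix)

namespace Summit.QuantumFields.YangMills.Theorems.AllWindowsColdBoxBoxHighLine

namespace GhostFP

open OrbitMapSurj (fpOperator_one_inv)

variable {H : ℕ}

/-- **The colour structure of the linearised link variation**: for `W = X ∘ w`,
`imVecM (X(θ_{e₋}) W_e − W_e X(θ_{e₊})) = −pauliPerm · ((θ_{e₋} + θ_{e₊}) × w_e)`. -/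
theorem imVecM_linkLinM_su2Coord (w : ZdEdge 4 → Fin 3 → ℝ) (θ : Site 4 → E3) (e : ZdEdge 4) :
    imVecM (linkLinM (fun e => su2Coord (w e)) θ e) =
      -(pauliPerm *ᵥ ((WithLp.ofLp (θ e.1) + WithLp.ofLp (θ (e.1 + Pi.single e.2 1))) ⨯₃ w e)) := by
  ext c
  fin_cases c <;>
    simp [imVecM, linkLinM, su2Coord, pauliPerm, cross_apply] <;> ring

/-- The coordinates of the basis site field: `basisField H (x,c) z = [z = x]·e_c`. -/
theorem ofLp_basisField (q : ↥(interiorSites H) × Fin 3) (z : Site 4) :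
    WithLp.ofLp (basisField H q z) = if z = (q.1 : Site 4) then Pi.single q.2 (1 : ℝ) else 0 := by
  unfold basisField
  by_cases hz : z ∈ interiorSites H
  · rw [extPauli_of_mem _ hz]
    by_cases hzq : z = (q.1 : Site 4)
    · rw [if_pos hzq]
      have hy : (⟨z, hz⟩ : ↥(interiorSites H)) = q.1 := Subtype.ext hzq
      rw [hy]
      funext b
      rw [vecToField, WithLp.ofLp_toLp, Pi.single_apply, Pi.single_apply]
      by_cases hb : b = q.2
      · subst hb; simp
      · have : (q.1, b) ≠ q := fun h => hb (congrArg Prod.snd h)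
        simp [hb, this]
    · rw [if_neg hzq]
      funext b
      rw [vecToField, WithLp.ofLp_toLp, Pi.single_apply, Pi.zero_apply]
      have : ((⟨z, hz⟩ : ↥(interiorSites H)), b) ≠ q := fun h => hzq (by rw [← h])
      simp [this]
  · rw [extPauli_of_not_mem _ hz]
    have hzq : z ≠ (q.1 : Site 4) := fun h => hz (h ▸ q.1.2)
    rw [if_neg hzq]
    rfl

/-- `(k·e_c × w)_c = 0`. -/
theorem cross_single_apply_self (k : ℝ) (c : Fin 3) (w : Fin 3 → ℝ) : ((k • Pi.single c (1 : ℝ)) ⨯₃ w) c = 0 := by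
  fin_cases c <;> simp [cross_apply]

/-- `pauliPerm · (pauliPerm · v) = v`. -/
theorem pauliPerm_mulVec_mulVec (v : Fin 3 → ℝ) : pauliPerm *ᵥ (pauliPerm *ᵥ v) = v := by
  rw [Matrix.mulVec_mulVec, pauliPerm_mul_self, Matrix.one_mulVec]

/-- The key cancellation: for `W = X ∘ w`, `θ = basisField H (x,c)` and any edge `e`, the `c`-component of `pauliPerm · imVecM (linkLinM W θ e)`
vanishes. -/
theorem pauliPerm_mulVec_imVecM_linkLinM_apply_self (w : ZdEdge 4 → Fin 3 → ℝ) (q : ↥(interiorSites H) × Fin 3) (e : ZdEdge 4) :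
    (pauliPerm *ᵥ imVecM (linkLinM (fun e => su2Coord (w e)) (basisField H q) e)) q.2 = 0 := by
  rw [imVecM_linkLinM_su2Coord, Matrix.mulVec_neg, pauliPerm_mulVec_mulVec, Pi.neg_apply, neg_eq_zero, ofLp_basisField,
    ofLp_basisField]
  have : ((if e.1 = (q.1 : Site 4) then Pi.single q.2 (1 : ℝ) else 0) +
      (if e.1 + Pi.single e.2 1 = (q.1 : Site 4) then Pi.single q.2 (1 : ℝ) else 0)) =
      ((if e.1 = (q.1 : Site 4) then (1 : ℝ) else 0) + (if e.1 + Pi.single e.2 1 = (q.1 : Site 4) then (1 : ℝ) else 0)) •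
        Pi.single q.2 (1 : ℝ) := by
    rw [add_smul]
    congr 1 <;> split_ifs <;> simp
  rw [this]
  exact cross_single_apply_self _ _ _

/-- The diagonal colour blocks of `pauliPerm · fpGen (X ∘ w)` have zero diagonal: `Σ_b P_{cb} · fpGen W (y,b) (x,c) = 0`. -/
theorem sum_pauliPerm_mul_fpGen_su2Coord (w : ZdEdge 4 → Fin 3 → ℝ) (x y : ↥(interiorSites H)) (c : Fin 3) :
    ∑ b : Fin 3, pauliPerm c b * fpGen H (fun e => su2Coord (w e)) (y, b) (x, c) = 0 := by
  have h : ∀ b, fpGen H (fun e => su2Coord (w e)) (y, b) (x, c) = divLinM (fun e => su2Coord (w e)) (basisField H (x, c)) y b :=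
    fun b => rfl
  simp only [h]
  have hmv : ∑ b : Fin 3, pauliPerm c b * divLinM (fun e => su2Coord (w e)) (basisField H (x, c)) y b =
      (pauliPerm *ᵥ divLinM (fun e => su2Coord (w e)) (basisField H (x, c)) y) c := rfl
  rw [hmv, divLinM, Matrix.mulVec_sum, Finset.sum_apply]
  refine Finset.sum_eq_zero fun μ _ => ?_
  rw [Matrix.mulVec_sub, Pi.sub_apply, pauliPerm_mulVec_imVecM_linkLinM_apply_self w (x, c),
    pauliPerm_mulVec_imVecM_linkLinM_apply_self w (x, c), sub_zero]

/-- **NO LINEAR GHOST TERM**: `tr (F₁⁻¹ · fpGen (X ∘ w)) = 0` for every su(2)-valued link field `w`. -/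
theorem trace_ghostX_su2Coord (w : ZdEdge 4 → Fin 3 → ℝ) : (ghostX H (fun e => su2Coord (w e))).trace = 0 := by
  rw [ghostX, fpOperator_one_inv, Matrix.trace]
  simp only [Matrix.diag_apply, Matrix.mul_apply, Matrix.neg_apply, Matrix.kroneckerMap_apply, Fintype.sum_prod_type]
  refine Finset.sum_eq_zero fun x _ => Finset.sum_eq_zero fun c _ => Finset.sum_eq_zero fun y _ => ?_
  have : ∑ b : Fin 3, -((dirichletMatrix (interiorSites H))⁻¹ x y * pauliPerm c b) * fpGen H (fun e => su2Coord (w e)) (y, b) (x, c) =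
      -(dirichletMatrix (interiorSites H))⁻¹ x y * ∑ b : Fin 3, pauliPerm c b * fpGen H (fun e => su2Coord (w e)) (y, b) (x, c) := by
    rw [Finset.mul_sum]
    exact Finset.sum_congr rfl fun b _ => by ring
  rw [this, sum_pauliPerm_mul_fpGen_su2Coord, mul_zero]

end GhostFP

end Summit.QuantumFields.YangMills.Theorems.AllWindowsColdBoxBoxHighLine

end
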